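import Mathlib
import HarnessLib
import Summits.Ventures.LatticeQCDFlow.Exactness.KickAngleJacobian
import Summits.Ventures.LatticeQCDFlow.Exactness.SphereGeodesicKick
import Summits.Ventures.LatticeQCDFlow.Exactness.SphereTangentialLaplacian
import Summits.Ventures.LatticeQCDFlow.Exactness.SphereLOFlowAction

/-!
# Lüscher's criterion at leading order for the Engel–Schaefer generator: `Σ_n div_n T = S − S₀`, and the first-order term of the printed Jacobian (18) is that divergence

HONEST FRAMING: exact (Metropolis-corrected) sampling algorithms for lattice gauge theory;
figures of merit are autocorrelation/cost numbers at stated couplings and volumes; no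
continuum-physics claim.

Venture `LatticeQCDFlow` (cell pub-lqcd), topic `Exactness`; FANOUT row 7 (`s0-cpn-null`: the
S0-D1 rung — 2D CP⁹, Lüscher's LO trivializing map inside HMC, Engel–Schaefer 2011).  NEW WORK of
the cell over Mathlib (`LinearMap.trace`, `NormedSpace.normalize`) and the tree's
`SphereLOFlowAction.lean` (`esAction`, `localField`, `loGenerator`, `loGenerator_eq`),
`SphereTangentialLaplacian.lean` (`hasFDerivAt_normalize`), `SphereGeodesicKick.lean`
(`tangentKick`, `inner_eq_norm_mul_cos_angle`) and `KickAngleJacobian.lean` (`kickJac`,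
`hasDerivAt_kickJac_zero`); nothing is cited as a fact.  Printed counterparts, NAMED ONLY:
M. Lüscher, Commun. Math. Phys. 293 (2010) 899, §3.2 eq. (3.9) (`ln det 𝓕_{t*} = ∫₀ᵗ ds Σ ∂·Z_s`,
Liouville's formula) and §4.1 eqs. (4.1)–(4.3) (the criterion `Σ_{x,μ} ∂^a Z^a_t − t ∂^a S Z^a_t
= S + Ċ_t`, whose `t = 0` instance is `Σ ∂·Z₀ = S + Ċ₀`); Engel–Schaefer, Comput. Phys. Commun.
182 (2011) 2107, §3 eqs. (15)–(18) (the LO potential, the generator `T_n`, the Euler step and its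
per-site Jacobian `𝒥_n = (1 − (ε_s Nβ/(2N−1)) J_nᵀx_n')(…)^{2N−2}`).

## Content (`E` a finite-dimensional real inner product space, `d = dim E`; configurations on the
product of unit spheres; couplings with no self-coupling and adjoint pairs, as in
`SphereLOFlowAction.lean`)

* `sphereDiv V u` — the divergence ON THE UNIT SPHERE of a vector field `V` tangent to it: the trace
  of the derivative at `u` of the extension `y ↦ V(y/‖y‖)` (E–S's recipe of eq. (12) applied to a
  vector field; the radial direction contributes nothing since the extension is constant along
  rays); `siteDiv n Z x` — the same at site `n` of a lattice field, the other sites frozen.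
* **`sphereDiv_smul_tangentKick`** — the divergence of the projected constant field:
  `div (y ↦ a (J − ⟪J, y⟫ y))(u) = −a (d − 1) ⟪J, u⟫` (`‖u‖ = 1`).
* **`siteDiv_loGenerator`** — for the leading-order generator `T_n = (κ/(d−1)) p_n` of
  `SphereLOFlowAction.lean`: `div_n T_n (x) = −κ ⟪J_n x, x_n⟫`.
* **`sum_siteDiv_loGenerator`** — LÜSCHER'S CRITERION AT LEADING ORDER:
  `Σ_n div_n T (x) = S(x) − S₀`.  This is eq. (4.3) of Lüscher at `t = 0` (`Σ ∂·Z₀ = S + Ċ₀`) for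
  the Engel–Schaefer generator — equivalently E–S eq. (15) read through `div ∘ grad = Δ` — i.e. the
  statement that to first order in the flow time the log-Jacobian of the flow reproduces the action
  (Lüscher eq. (4.1): `ln det 𝓕_{t*} = t S + C_t + O(t²)`).
* **`hasDerivAt_kickJac_loStep`** — LIOUVILLE'S FORMULA, PER SITE, ON THE PRINTED JACOBIAN: with
  `dim E = m + 2`, the `ε`-derivative at `ε = 0` of the printed per-site Jacobian
  `kickJac (ε (κ/(m+1)) ‖J_n‖) m θ'_n` of the Euler step (E–S eq. (18), `θ'_n = ∠(J_n, x_n) ∈ (0, π)`)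
  EQUALS `div_n T_n (x)`; hence (`sum_hasDerivAt_kickJac_loStep`) the `ε`-derivative at `0` of
  `Σ_n kickJac(…)` — the first-order term of the sweep's log-Jacobian, all factors being `1` at
  `ε = 0` — is `S − S₀`.

NOT CLAIMED: the `O(ε²)` remainder or any statement at finite `ε` / finite flow time (the exact
finite-step Jacobian is the tree's `SphereKickJacobian*`, its use in THMC `SphereSweepTHMC*`);
that the sequential sweep and the simultaneous flow agree beyond first order; Lüscher's criterion
for `t > 0` (higher orders `S̃⁽ᵏ⁾`); the `U(1)` links (parameters); anything quantitative.
-/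

noncomputable section

namespace Summit.Ventures.LatticeQCDFlow.Exactness

open NormedSpace Filter Real InnerProductGeometry
open scoped RealInnerProductSpace Topology

variable {E : Type*} [NormedAddCommGroup E] [InnerProductSpace ℝ E]

/-! ## §1 The divergence on the unit sphere of a tangent field, via the extension `y ↦ V(y/‖y‖)` -/

section SphereDiv

/-- **The divergence on the unit sphere** of a vector field `V : E → E` tangent to it, at a unit
vector `u`: the trace of the derivative at `u` of the degree-`0` extension `y ↦ V(y/‖y‖)` (whose
derivative kills the radial direction, so the ambient trace is the tangential one). -/
def sphereDiv (V : E → E) (u : E) : ℝ :=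
  LinearMap.trace ℝ E (fderiv ℝ (fun y : E => V (normalize y)) u).toLinearMap

variable [FiniteDimensional ℝ E]

/-- **The divergence of the projected constant field** `y ↦ a • (J − ⟪J, y⟫ y)` (`= a • p`, the
tangential part of the constant field `J`, E–S's `p_n`) on the unit sphere:
`div (a • p)(u) = −a (d − 1) ⟪J, u⟫` for `‖u‖ = 1`, `d = dim E`. -/
theorem sphereDiv_smul_tangentKick {u : E} (hu : ‖u‖ = 1) (a : ℝ) (J : E) :
    sphereDiv (fun y => a • tangentKick J y) u = -(a * ((Module.finrank ℝ E : ℝ) - 1) * ⟪J, u⟫) := by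
  have hu0 : u ≠ 0 := by rintro rfl; simp at hu
  have hνu : normalize u = u := normalize_eq_self_of_norm_eq_one hu
  set P : E →L[ℝ] E := (‖u‖⁻¹ : ℝ) • (ContinuousLinearMap.id ℝ E -
    (innerSL ℝ (normalize u)).smulRight (normalize u)) with hP
  have hν : HasFDerivAt (normalize : E → E) P u := hasFDerivAt_normalize hu0
  have hPapp : ∀ h : E, P h = h - ⟪u, h⟫ • u := fun h => by
    simp [hP, hνu, hu]
  have hφ : HasFDerivAt (fun y : E => innerSL ℝ J (normalize y)) ((innerSL ℝ J).comp P) u :=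
    (innerSL ℝ J).hasFDerivAt.comp u hν
  have hψ : HasFDerivAt (fun y : E => innerSL ℝ J (normalize y) • normalize y)
      (innerSL ℝ J (normalize u) • P + ((innerSL ℝ J).comp P).smulRight (normalize u)) u :=
    hφ.smul hν
  have hg : HasFDerivAt (fun y : E => a • (J - innerSL ℝ J (normalize y) • normalize y))
      (a • ((0 : E →L[ℝ] E) -
        (innerSL ℝ J (normalize u) • P + ((innerSL ℝ J).comp P).smulRight (normalize u)))) u :=
    ((hasFDerivAt_const J u).sub hψ).const_smul a
  have hfun : (fun y : E => a • tangentKick J (normalize y)) =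
      fun y : E => a • (J - innerSL ℝ J (normalize y) • normalize y) := by
    funext y; simp only [tangentKick, innerSL_apply_apply]
  unfold sphereDiv
  rw [hfun, hg.fderiv, LinearMap.trace_eq_sum_inner _ (stdOrthonormalBasis ℝ E)]
  set b := stdOrthonormalBasis ℝ E with hb
  -- each diagonal entry
  have hterm : ∀ i, ⟪b i, (a • ((0 : E →L[ℝ] E) -
      (innerSL ℝ J (normalize u) • P + ((innerSL ℝ J).comp P).smulRight (normalize u)))).toLinearMap
        (b i)⟫ =
      -a * ⟪J, u⟫ + a * ⟪J, u⟫ * (⟪u, b i⟫ * ⟪b i, u⟫) - a * (⟪J, b i⟫ * ⟪b i, u⟫)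
        + a * ⟪J, u⟫ * (⟪u, b i⟫ * ⟪b i, u⟫) := by
    intro i
    have h1 : ⟪b i, b i⟫ = (1 : ℝ) := by
      rw [real_inner_self_eq_norm_sq, b.orthonormal.1 i, one_pow]
    simp only [ContinuousLinearMap.coe_coe, zero_sub, smul_apply, neg_apply, add_apply,
      ContinuousLinearMap.smulRight_apply, ContinuousLinearMap.coe_comp, Function.comp_apply,
      innerSL_apply_apply, hνu, hPapp, inner_smul_right, inner_neg_right, inner_add_right,
      inner_sub_right, h1]
    ring
  simp_rw [hterm]
  simp only [Finset.sum_add_distrib, Finset.sum_sub_distrib, ← Finset.mul_sum,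
    b.sum_inner_mul_inner, Finset.sum_const, Finset.card_univ, nsmul_eq_mul]
  rw [← finrank_eq_card_orthonormalBasis b, real_inner_self_eq_norm_sq, hu]
  ring

end SphereDiv

/-! ## §2 The site divergence of the leading-order generator and Lüscher's criterion at `t = 0` -/

section SiteDiv

variable {Λ : Type*} [Fintype Λ] [DecidableEq Λ]

/-- **The divergence at site `n`** of (the `n`-th component of) a lattice vector field
`Z : (Λ → E) → E`, tangent to the `n`-th site sphere, the other sites frozen:
`div_n Z (x) = sphereDiv (y ↦ Z(x with x_n ← y)) (x n)`. -/
def siteDiv (n : Λ) (Z : (Λ → E) → E) (x : Λ → E) : ℝ :=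
  sphereDiv (fun y => Z (Function.update x n y)) (x n)

variable [FiniteDimensional ℝ E] {U : Λ → Λ → (E →L[ℝ] E)}

/-- **The site divergence of the leading-order generator**: `div_n T_n (x) = −κ ⟪J_n x, x_n⟫` for
`T_n = (κ/(d−1)) p_n` (`SphereLOFlowAction.loGenerator_eq`) on the product of unit spheres — the
`(d−1)` of the divergence of the projected field cancels the `1/(d−1)` of E–S eq. (15)/(16). -/
theorem siteDiv_loGenerator (hU0 : ∀ n, U n n = 0)
    (hUadj : ∀ m n (v w : E), ⟪U m n v, w⟫ = ⟪v, U n m w⟫) (hd : 2 ≤ Module.finrank ℝ E)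
    (κ S₀ : ℝ) {x : Λ → E} {n : Λ} (hx : ‖x n‖ = 1) :
    siteDiv n (loGenerator κ S₀ U n) x = -(κ * ⟪localField U n x, x n⟫) := by
  have hx0 : x n ≠ 0 := by intro h; rw [h, norm_zero] at hx; exact zero_ne_one hx
  have hd' : ((Module.finrank ℝ E : ℝ) - 1) ≠ 0 := by
    have : (2 : ℝ) ≤ Module.finrank ℝ E := by exact_mod_cast hd
    intro h; linarith
  -- near `x n`, the generator at the configuration `x_n ← y/‖y‖` is the projected constant field
  have hev : (fun y : E => loGenerator κ S₀ U n (Function.update x n (normalize y))) =ᶠ[𝓝 (x n)]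
      fun y : E => (κ / ((Module.finrank ℝ E : ℝ) - 1)) •
        tangentKick (localField U n x) (normalize y) := by
    filter_upwards [eventually_ne_nhds hx0] with y hy
    have hy1 : ‖Function.update x n (normalize y) n‖ = 1 := by
      rw [Function.update_self]; exact norm_normalize hy
    rw [loGenerator_eq hU0 hUadj hd κ S₀ hy1, localField_update_self hU0, Function.update_self]
  unfold siteDiv sphereDiv
  rw [hev.fderiv_eq]
  have h := sphereDiv_smul_tangentKick hx (κ / ((Module.finrank ℝ E : ℝ) - 1)) (localField U n x)
  unfold sphereDiv at h
  rw [h]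
  field_simp

/-- **Lüscher's criterion at leading order for the Engel–Schaefer generator**:
`Σ_n div_n T (x) = S(x) − S₀` on the product of unit spheres — eq. (4.3) of Lüscher (CMP 293
(2010)) at `t = 0`, `Σ ∂·Z₀ = S + Ċ₀`, for `Z₀ = T = −∂̃S̃⁽⁰⁾` with E–S's `S̃⁽⁰⁾ = S/(2(d−1))`;
equivalently, by Liouville's formula, the first-order term in the flow time of the log-Jacobian of
the flow is the action itself (Lüscher eq. (4.1) to first order). -/
theorem sum_siteDiv_loGenerator (hU0 : ∀ n, U n n = 0)
    (hUadj : ∀ m n (v w : E), ⟪U m n v, w⟫ = ⟪v, U n m w⟫) (hd : 2 ≤ Module.finrank ℝ E)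
    (κ S₀ : ℝ) {x : Λ → E} (hx : ∀ n, ‖x n‖ = 1) :
    ∑ n, siteDiv n (loGenerator κ S₀ U n) x = esAction κ S₀ U x - S₀ := by
  rw [esAction_sub_const]
  simp_rw [siteDiv_loGenerator hU0 hUadj hd κ S₀ (hx _)]
  rw [Finset.mul_sum]
  refine Finset.sum_congr rfl fun n _ => ?_
  rw [real_inner_comm (x n)]
  ring

end SiteDiv

/-! ## §3 Liouville's formula on the printed Jacobian: `d/dε 𝒥_n|₀ = div_n T_n`, `Σ_n d/dε 𝒥_n|₀ = S − S₀` -/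

section PrintedJacobian

variable {Λ : Type*} [Fintype Λ] [DecidableEq Λ] [FiniteDimensional ℝ E]
  {U : Λ → Λ → (E →L[ℝ] E)}

/-- **Liouville's formula, per site, on the printed Jacobian.**  Let `dim E = m + 2` (site sphere
`S^{m+1}`; CP(N−1): `m = 2N − 2`).  The Euler step of the leading-order flow at site `n` with step
`ε` is the geodesic kick with constant `c = ε κ/(m+1)` (`SphereLOFlowAction.eulerStep_loGenerator`),
whose exact Jacobian against the site sphere's measure is the printed factor
`kickJac (c ‖J_n‖) m θ'_n`, `θ'_n = ∠(J_n x, x_n)` (E–S eq. (18); tree `SphereKickJacobian*`).  Its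
`ε`-derivative at `ε = 0` is the site divergence of the generator:
`d/dε kickJac(ε (κ/(m+1)) ‖J_n‖) m θ'_n |₀ = div_n T_n (x) = −κ ⟪J_n x, x_n⟫`, for `x_n` off the
two poles `±Ĵ_n` (`θ'_n ∈ (0, π)`, where the printed formula is the Jacobian). -/
theorem hasDerivAt_kickJac_loStep (hU0 : ∀ n, U n n = 0)
    (hUadj : ∀ m n (v w : E), ⟪U m n v, w⟫ = ⟪v, U n m w⟫) {m : ℕ}
    (hm : Module.finrank ℝ E = m + 2) (κ S₀ : ℝ) {x : Λ → E} {n : Λ} (hx : ‖x n‖ = 1)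
    (hθ : angle (localField U n x) (x n) ∈ Set.Ioo 0 π) :
    HasDerivAt (fun ε : ℝ => kickJac (ε * (κ / ((m : ℝ) + 1)) * ‖localField U n x‖) m
        (angle (localField U n x) (x n)))
      (siteDiv n (loGenerator κ S₀ U n) x) 0 := by
  have hd : 2 ≤ Module.finrank ℝ E := by omega
  have hdm : ((Module.finrank ℝ E : ℝ) - 1) = (m : ℝ) + 1 := by
    rw [hm]; push_cast; ring
  have hm1 : ((m : ℝ) + 1) ≠ 0 := by positivity
  rw [siteDiv_loGenerator hU0 hUadj hd κ S₀ hx,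
    inner_eq_norm_mul_cos_angle (localField U n x) hx]
  -- chain rule through `ε ↦ ε (κ/(m+1)) ‖J‖` and `KickAngleJacobian.hasDerivAt_kickJac_zero`
  set J := localField U n x with hJdef
  set θ := angle J (x n) with hθdef
  have hlin : HasDerivAt (fun ε : ℝ => ε * (κ / ((m : ℝ) + 1)) * ‖J‖)
      (κ / ((m : ℝ) + 1) * ‖J‖) 0 := by
    have hf : (fun ε : ℝ => ε * (κ / ((m : ℝ) + 1)) * ‖J‖) =
        fun ε : ℝ => ε * (κ / ((m : ℝ) + 1) * ‖J‖) := by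
      funext ε; ring
    rw [hf]
    exact hasDerivAt_mul_const _
  have hJ := hasDerivAt_kickJac_zero m hθ
  have h0 : (0 : ℝ) * (κ / ((m : ℝ) + 1)) * ‖J‖ = 0 := by ring
  rw [← h0] at hJ
  have hcomp := hJ.comp 0 hlin
  simp only [Function.comp_def] at hcomp
  refine hcomp.congr_deriv ?_
  rw [show -((m : ℝ) + 1) * cos θ * (κ / ((m : ℝ) + 1) * ‖J‖) =
      -(cos θ * ‖J‖) * (κ / ((m : ℝ) + 1) * ((m : ℝ) + 1)) by ring, div_mul_cancel₀ κ hm1]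
  ring

/-- **The first-order term of the sweep's log-Jacobian is the action.**  Summing Liouville's
formula over the sites (each printed factor equals `1` at `ε = 0`, so the `ε`-derivative at `0` of
the product of the factors, or of the sum of their logarithms, is the sum of their derivatives):
`d/dε Σ_n kickJac(ε (κ/(m+1)) ‖J_n‖) m θ'_n |₀ = S(x) − S₀` — Lüscher's eq. (4.1),
`ln det 𝓕_{t*} = t S + C_t`, at leading order in the flow time, for the Engel–Schaefer map. -/
theorem sum_hasDerivAt_kickJac_loStep (hU0 : ∀ n, U n n = 0)
    (hUadj : ∀ m n (v w : E), ⟪U m n v, w⟫ = ⟪v, U n m w⟫) {m : ℕ}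
    (hm : Module.finrank ℝ E = m + 2) (κ S₀ : ℝ) {x : Λ → E} (hx : ∀ n, ‖x n‖ = 1)
    (hθ : ∀ n, angle (localField U n x) (x n) ∈ Set.Ioo 0 π) :
    HasDerivAt (fun ε : ℝ => ∑ n, kickJac (ε * (κ / ((m : ℝ) + 1)) * ‖localField U n x‖) m
        (angle (localField U n x) (x n)))
      (esAction κ S₀ U x - S₀) 0 := by
  have hd : 2 ≤ Module.finrank ℝ E := by omega
  rw [← sum_siteDiv_loGenerator hU0 hUadj hd κ S₀ hx]
  exact HasDerivAt.fun_sum (u := Finset.univ)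
    (A := fun n ε => kickJac (ε * (κ / ((m : ℝ) + 1)) * ‖localField U n x‖) m
      (angle (localField U n x) (x n)))
    (A' := fun n => siteDiv n (loGenerator κ S₀ U n) x) (x := 0)
    fun n _ => hasDerivAt_kickJac_loStep hU0 hUadj hm κ S₀ (hx n) (hθ n)

end PrintedJacobian

end Summit.Ventures.LatticeQCDFlow.Exactness

end
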